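import Literature.AnabelianGeometry.SemiGraphs.Commensurability

/-!
# Proof of the group-theoretic observation of [SemiAnbd] Remark 2.5.1

Mochizuki, *Semi-graphs of anabelioids*, Publ. RIMS **42** (2006) 221–322, §2, Remark 2.5.1, p. 27
[cite: MochizukiSemiAnbd2006, Rem. 2.5.1 p.27]: for `G = ℤ/lℤ`, `G^ℕ` with the product topology and
the shift `α` induced by `n ↦ n + 1`, "there does not exist a proper open subgroup `H ⊆ G^ℕ` such that
`H = α⁻¹(H)`".  We DISCHARGE the named fact `remark_2_5_1` of `Commensurability.lean`: an open
subgroup contains a basic neighbourhood `K_N = {x | x_i = 1 (i < N)}` of the identity; and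
`α(K_n) ⊆ K_{n+1}`, so `H = α⁻¹(H) ⊇ K_{n+1}` forces `H ⊇ K_n`; descending to `K_0 = G^ℕ` gives
`H = G^ℕ` (the argument works for any group in place of `ℤ/lℤ`).
-/

namespace Literature.AnabelianGeometry.SemiGraphs

universe u

/-- The basic open subgroups `K_N = {x | x_i = 1 for i < N}` of a product `ℕ → G`.
[cite: MochizukiSemiAnbd2006, Rem. 2.5.1 p.27] -/
def cylinderSubgroup (G : Type u) [Group G] (N : ℕ) : Subgroup (ℕ → G) where
  carrier := {x | ∀ i, i < N → x i = 1}
  one_mem' := fun _ _ => rfl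
  mul_mem' {x y} hx hy := fun i hi => by simp [Pi.mul_apply, hx i hi, hy i hi]
  inv_mem' {x} hx := fun i hi => by simp [Pi.inv_apply, hx i hi]

/-- The shift sends `K_n` into `K_{n+1}`: `(α x)_0 = 1` and `(α x)_{i+1} = x_i`.
[cite: MochizukiSemiAnbd2006, Rem. 2.5.1 p.27] -/
theorem shiftHom_mem_cylinderSubgroup {G : Type u} [Group G] {n : ℕ} {x : ℕ → G}
    (hx : x ∈ cylinderSubgroup G n) : shiftHom G x ∈ cylinderSubgroup G (n + 1) := by
  intro i hi
  cases i with
  | zero => rfl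
  | succ j => exact hx j (Nat.lt_of_succ_lt_succ hi)

/-- An open subgroup of `ℕ → G` (product topology, `G` discrete or not) contains some `K_N`.
[cite: MochizukiSemiAnbd2006, Rem. 2.5.1 p.27] -/
theorem exists_cylinderSubgroup_le {G : Type u} [Group G] [TopologicalSpace G]
    (H : Subgroup (ℕ → G)) (hH : IsOpen (H : Set (ℕ → G))) :
    ∃ N : ℕ, cylinderSubgroup G N ≤ H := by
  obtain ⟨I, u, hu, hsub⟩ := isOpen_pi_iff.mp hH 1 H.one_mem
  refine ⟨I.sup id + 1, fun x hx => hsub fun a ha => ?_⟩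
  have hlt : a < I.sup id + 1 := Nat.lt_succ_of_le (Finset.le_sup (f := id) (Finset.mem_coe.mp ha))
  rw [hx a hlt]
  exact (hu a (Finset.mem_coe.mp ha)).2

/-- [SemiAnbd] Remark 2.5.1, the observation, for an arbitrary group `G`: an open subgroup
`H ⊆ G^ℕ` with `H = α⁻¹(H)` is everything. [cite: MochizukiSemiAnbd2006, Rem. 2.5.1 p.27] -/
theorem eq_top_of_isOpen_of_comap_shiftHom_eq {G : Type u} [Group G] [TopologicalSpace G]
    (H : Subgroup (ℕ → G)) (hH : IsOpen (H : Set (ℕ → G))) (hα : H.comap (shiftHom G) = H) :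
    H = ⊤ := by
  obtain ⟨N, hN⟩ := exists_cylinderSubgroup_le H hH
  -- descend: `K_{n+1} ≤ H → K_n ≤ H`
  have step : ∀ n, cylinderSubgroup G (n + 1) ≤ H → cylinderSubgroup G n ≤ H := by
    intro n hn x hx
    have hmem : shiftHom G x ∈ H := hn (shiftHom_mem_cylinderSubgroup hx)
    have : x ∈ H.comap (shiftHom G) := hmem
    rwa [hα] at this
  have descend : ∀ n, cylinderSubgroup G n ≤ H → cylinderSubgroup G 0 ≤ H := by
    intro n
    induction n with
    | zero => exact id
    | succ n ih => exact fun h => ih (step n h)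
  rw [eq_top_iff]
  intro x _
  exact descend N hN (fun i hi => absurd hi (Nat.not_lt_zero i))

/-- NAMED FACT `remark_2_5_1` ([SemiAnbd] Remark 2.5.1, p. 27), PROVED.
[cite: MochizukiSemiAnbd2006, Rem. 2.5.1 p.27] -/
theorem remark_2_5_1_holds : remark_2_5_1 :=
  fun _ _ H hH hα => eq_top_of_isOpen_of_comap_shiftHom_eq H hH hα

end Literature.AnabelianGeometry.SemiGraphs
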